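import Mathlib
import Literature.Probability.LatticeModels.TorusFourier
import Literature.MathematicalPhysics.QuantumLattice.FermiRG.Salmhofer1998SublevelVolume
import Literature.MathematicalPhysics.QuantumLattice.FermiRG.FST2Hypotheses
import HarnessLib

/-!
# Level counting on the square torus grid for a REGULAR band: `#{k⃗ : |e(p_k⃗)| ≤ η} ≤ c₁ η L² + c₂ L`

Topic `MathematicalPhysics/QuantumLattice`; companion of `TorusShellCounting.lean` (the FREE band
`ε = -2cos p₁ - 2cos p₂` away from `μ ∈ {0, ±4}`, by the explicit row structure of `cos`).  Here the band is
an ARBITRARY `C²` function with a gradient floor on its thin shell — the setting of the moving frames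
`e_K = ε - μ - K` of a Wilsonian flow with counterterms (Feldman–Salmhofer–Trubowitz's `E = e + K`), whose
only uniform geometric data are the FST II constants `GeomConstants e K r₀ g₀ w` (`FermiRG/FST2Hypotheses`:
`‖Dʲe‖ ≤ K` for `j ≤ 2`, `|∇e| ≥ g₀` on `{|e| < r₀}`).  We PROVE the finite-volume density-of-states bound

  `#{k⃗ ∈ (ℤ/Lℤ)² : |e(2πk⃗/L)| ≤ η} ≤ (4N/(π c₀))·η·L² + 2N·L`,  every `L ≥ 1`,

whenever every counted grid point has a coordinate partial derivative `≥ c₀` in size and the partials are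
`Kc`-Lipschitz along their own coordinate lines, for any `N ≥ 4πKc/c₀` (`card_le_of_coordFloor`); in Fréchet
form for `f : EuclideanSpace ℝ (Fin 2) → ℝ` of class `C²` with `‖D²f‖ ≤ Kc` and `|f| < r ⇒ ‖Df‖ ≥ g₀`
(`card_filter_abs_lt_le_of_gradient_floor`, `…_abs_le_…`, constants `(8N/(πg₀), 2N)` for `N ≥ 8πKc/g₀`), and
keyed by FST II's predicate (`card_filter_abs_lt_le_of_geomConstants`).  No `L ≥ L₀` threshold and no loss in
`η` (the count is taken AT the grid points, not through a thickened continuum band), so `η` may go up to the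
tube radius `r₀` itself.

This is the discretisation of the one ingredient about the dispersion relation in Salmhofer's proof of his
Lemma 4 ((5.19)–(5.21): `∫ 1(|E| ≤ ε) ≤ 2J₁ε` "by a change of coordinates", render
`paper:arxiv-cond-mat_9706188` p.20 L26–34; tree: `Salmhofer1998SublevelVolume`, whose one-dimensional piece
lemma `Salmhofer1998.abs_sub_le_of_piece` we reuse verbatim): below the tube radius every shell point has a
coordinate derivative `≥ c₀ = g₀/2`; cut each grid LINE of that coordinate into `N` pieces so short
(`Kc · 2π/N ≤ c₀/2`) that the partial keeps its sign and size `≥ c₀/2` on every piece holding such a point;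
there `e` is monotone along the line with speed `≥ c₀/2`, so the shell points of the piece have angles within
`4η/c₀` of each other, i.e. at most `(4η/c₀)(L/2π) + 1` residues; `2` directions × `L` lines × `N` pieces.
It is the `L`-UNIFORM level count ("bounds uniform in `L`", Benfatto–Giuliani–Mastropietro 2006 §2.3 fn. 1)
that the Gram constant of a single-scale propagator consumes (de Siqueira Pedra–Salmhofer 2008, Lemma 5.1;
tree: `InfraredCutoffGramConstant.sum_one_sub_cutoff_div_sqrt_le`, hypothesis `hcount`, in exactly this
shape `c₁ η L² + c₂ L`).

Everything is proved; no definition, no named fact, no `instance`, no `notation`.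

## References

* M. Salmhofer, Commun. Math. Phys. 194 (1998) 249–295, Lemma 4 proof, (5.19)–(5.21). [Salmhofer1998]
* W. de Siqueira Pedra, M. Salmhofer, Commun. Math. Phys. 282 (2008) 797–818, Lemma 5.1. [PedraSalmhofer2008]
* G. Benfatto, A. Giuliani, V. Mastropietro, Ann. Henri Poincaré 7 (2006) 809–898, §2.3 footnote 1, §2.8 (2.80).
  [BenfattoGiulianiMastropietro2006]
* J. Feldman, M. Salmhofer, E. Trubowitz, Commun. Pure Appl. Math. 51 (1998) 1133–1246, §2.1–2.2 (the constants
  `|e|₂, r₀, g₀`). [FeldmanSalmhoferTrubowitz1998]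
-/

noncomputable section

namespace Literature.MathematicalPhysics.QuantumLattice

open Real Set Finset Literature.Probability.LatticeModels
open Literature.MathematicalPhysics.QuantumLattice.FermiRG

/-! ### Combinatorics: a set of naturals of small diameter is small -/

/-- A finite set of naturals all of whose (real) differences are `≤ D` has at most `D + 1` elements
(non-strict companion of `card_le_of_forall_sub_lt`). [folklore] -/
private theorem card_le_of_forall_sub_le {S : Finset ℕ} {D : ℝ} (hD : 0 ≤ D)
    (h : ∀ a ∈ S, ∀ b ∈ S, ((b : ℝ) - a) ≤ D) : (S.card : ℝ) ≤ D + 1 := by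
  rcases S.eq_empty_or_nonempty with rfl | hne
  · simp; linarith
  · set m := S.min' hne with hm
    have hsub : S ⊆ Finset.Icc m (m + ⌊D⌋₊) := by
      intro b hb
      rw [Finset.mem_Icc]
      refine ⟨Finset.min'_le S b hb, ?_⟩
      have h1 := h m (Finset.min'_mem S hne) b hb
      have h3 : (b : ℕ) - m ≤ ⌊D⌋₊ := by
        refine Nat.le_floor ?_
        have hmb : m ≤ b := Finset.min'_le S b hb
        push_cast [Nat.cast_sub hmb]
        exact h1
      omega
    have hcard := Finset.card_le_card hsub
    rw [Nat.card_Icc] at hcard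
    calc (S.card : ℝ) ≤ ((m + ⌊D⌋₊ + 1 - m : ℕ) : ℝ) := by exact_mod_cast hcard
      _ = ⌊D⌋₊ + 1 := by
          rw [show m + ⌊D⌋₊ + 1 - m = ⌊D⌋₊ + 1 by omega]; push_cast; ring
      _ ≤ D + 1 := by linarith [Nat.floor_le hD]

/-! ### One family of grid lines: fibres × pieces -/

variable {L : ℕ} [NeZero L]

/-- **Lines lemma.**  Let `T` be a set of grid points `k ∈ (ℤ/Lℤ)²`, fibred by `fib k` and coordinatised
inside each fibre by `coord k` (jointly injective on `T`), and let `h y`, `y ∈ ℤ/Lℤ`, be line functions with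
derivatives `h' y` that are `Kc`-Lipschitz.  If at every point of `T` the line function is `η`-small,
`|h (fib k) (2π·coord k/L)| ≤ η`, and steep, `c₀ ≤ |h' (fib k) (2π·coord k/L)|`, then for any `N ≥ 1` with
`4πKc ≤ c₀N`:  `#T ≤ L · N · ((4η/c₀)(L/2π) + 1)` — on each of the `N` pieces of length `2π/N` of a line the
steep small points have angles within `4η/c₀` (`Salmhofer1998.abs_sub_le_of_piece`).
[cite: Salmhofer1998, Lemma 4 proof (5.19)–(5.21) (p.20 L26–34)] -/
theorem card_le_of_lines (T : Finset (TorusSite 2 L)) (fib coord : TorusSite 2 L → ZMod L)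
    (hinj : ∀ k ∈ T, ∀ k' ∈ T, fib k = fib k' → coord k = coord k' → k = k')
    (h h' : ZMod L → ℝ → ℝ) {Kc c₀ η : ℝ} (hKc : 0 ≤ Kc) (hc₀ : 0 < c₀) (hη : 0 ≤ η)
    (hh : ∀ y s, HasDerivAt (h y) (h' y s) s)
    (hlip : ∀ y s s', |h' y s - h' y s'| ≤ Kc * |s - s'|)
    (hsmall : ∀ k ∈ T, |h (fib k) (2 * π * ((coord k).val : ℝ) / L)| ≤ η)
    (hsteep : ∀ k ∈ T, c₀ ≤ |h' (fib k) (2 * π * ((coord k).val : ℝ) / L)|)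
    {N : ℕ} (hN0 : 0 < N) (hN : 4 * π * Kc ≤ c₀ * N) :
    (T.card : ℝ) ≤ L * (N * (4 * η / c₀ * (L / (2 * π)) + 1)) := by
  have hL : (0 : ℝ) < L := by exact_mod_cast Nat.pos_of_ne_zero (NeZero.ne L)
  have hπ := Real.pi_pos
  have hNr : (0 : ℝ) < N := by exact_mod_cast hN0
  -- the piece length
  set ℓ : ℝ := 2 * π / N with hℓ
  have hℓpos : 0 < ℓ := by positivity
  have hKℓ : Kc * ℓ ≤ c₀ / 2 := by
    rw [hℓ, mul_div_assoc', div_le_iff₀ hNr]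
    linarith
  set D : ℝ := 4 * η / c₀ * (L / (2 * π)) with hD
  have hD0 : 0 ≤ D := by positivity
  -- fibre over `fib`
  have hfib := Finset.card_eq_sum_card_fiberwise (f := fib) (s := T) (t := Finset.univ)
    (fun _ _ => Finset.mem_univ _)
  -- one fibre
  have hrow : ∀ y : ZMod L, (((T.filter fun k => fib k = y)).card : ℝ) ≤ N * (D + 1) := by
    intro y
    set F := T.filter fun k => fib k = y with hF
    -- coordinatise the fibre by the natural representative of `coord`
    have hinjF : Set.InjOn (fun k : TorusSite 2 L => (coord k).val) F := by
      intro k hk k' hk' hkk'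
      rw [Finset.mem_coe, hF, Finset.mem_filter] at hk hk'
      exact hinj k hk.1 k' hk'.1 (hk.2.trans hk'.2.symm) (ZMod.val_injective L hkk')
    rw [← Finset.card_image_of_injOn hinjF]
    set I := F.image fun k : TorusSite 2 L => (coord k).val with hI
    -- what membership in `I` gives
    have hmemI : ∀ a ∈ I, (a : ℝ) < L ∧ |h y (2 * π * (a : ℝ) / L)| ≤ η ∧
        c₀ ≤ |h' y (2 * π * (a : ℝ) / L)| := by
      intro a ha
      rw [hI, Finset.mem_image] at ha
      obtain ⟨k, hk, rfl⟩ := ha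
      rw [hF, Finset.mem_filter] at hk
      refine ⟨by exact_mod_cast ZMod.val_lt (coord k), ?_, ?_⟩
      · have := hsmall k hk.1; rwa [hk.2] at this
      · have := hsteep k hk.1; rwa [hk.2] at this
    -- the pieces
    set P : ℕ → Finset ℕ := fun m => I.filter fun a =>
      (m : ℝ) * ℓ ≤ 2 * π * (a : ℝ) / L ∧ 2 * π * (a : ℝ) / L ≤ (m : ℝ) * ℓ + ℓ with hP
    have hcover : I ⊆ (Finset.range N).biUnion P := by
      intro a ha
      obtain ⟨haL, -, -⟩ := hmemI a ha
      set t : ℝ := 2 * π * (a : ℝ) / L with ht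
      have ht0 : 0 ≤ t := by positivity
      have ht2π : t < 2 * π := by
        rw [ht, div_lt_iff₀ hL]; nlinarith
      set m : ℕ := ⌊t / ℓ⌋₊ with hm
      have hm1 : (m : ℝ) ≤ t / ℓ := Nat.floor_le (by positivity)
      have hm2 : t / ℓ < m + 1 := Nat.lt_floor_add_one _
      have htℓ : t / ℓ < N := by
        rw [hℓ, div_div_eq_mul_div, div_lt_iff₀ (by positivity : (0 : ℝ) < 2 * π)]
        calc t * N < 2 * π * N := by nlinarith
          _ = N * (2 * π) := by ring
      rw [Finset.mem_biUnion]
      refine ⟨m, ?_, ?_⟩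
      · rw [Finset.mem_range]
        exact_mod_cast hm1.trans_lt htℓ
      · rw [hP, Finset.mem_filter]
        refine ⟨ha, ?_, ?_⟩
        · have := (le_div_iff₀ hℓpos).1 hm1
          linarith
        · have := (div_lt_iff₀ hℓpos).1 hm2
          linarith
    -- each piece is small
    have hpiece : ∀ m : ℕ, ((P m).card : ℝ) ≤ D + 1 := by
      intro m
      refine card_le_of_forall_sub_le hD0 ?_
      intro a ha b hb
      rw [hP, Finset.mem_filter] at ha hb
      obtain ⟨haI, ha1, ha2⟩ := ha
      obtain ⟨hbI, hb1, hb2⟩ := hb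
      obtain ⟨-, hasm, hast⟩ := hmemI a haI
      obtain ⟨-, hbsm, -⟩ := hmemI b hbI
      have hamem : 2 * π * (a : ℝ) / L ∈ Icc ((m : ℝ) * ℓ) ((m : ℝ) * ℓ + ℓ) := ⟨ha1, ha2⟩
      have hbmem : 2 * π * (b : ℝ) / L ∈ Icc ((m : ℝ) * ℓ) ((m : ℝ) * ℓ + ℓ) := ⟨hb1, hb2⟩
      have key := Salmhofer1998.abs_sub_le_of_piece (hh y) hKc (hlip y) hc₀ hKℓ hamem hast hamem hbmem
        hasm hbsm
      -- `|s - s'| ≤ 4η/c₀` in angle ⇒ `b - a ≤ D` in index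
      have hdiff : 2 * π * (b : ℝ) / L - 2 * π * (a : ℝ) / L = ((b : ℝ) - a) * (2 * π / L) := by
        field_simp
      have h2πL : 0 < 2 * π / L := by positivity
      have habs : ((b : ℝ) - a) * (2 * π / L) ≤ 4 * η / c₀ := by
        rw [← hdiff]
        calc 2 * π * (b : ℝ) / L - 2 * π * (a : ℝ) / L
            ≤ |2 * π * (a : ℝ) / L - 2 * π * (b : ℝ) / L| := by
              rw [abs_sub_comm]; exact le_abs_self _
          _ ≤ 4 * η / c₀ := key
      rw [hD]
      rw [← le_div_iff₀ h2πL] at habs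
      calc ((b : ℝ) - a) ≤ 4 * η / c₀ / (2 * π / L) := habs
        _ = 4 * η / c₀ * (L / (2 * π)) := by field_simp
    calc (I.card : ℝ) ≤ (((Finset.range N).biUnion P).card : ℝ) := by
          exact_mod_cast Finset.card_le_card hcover
      _ ≤ ∑ m ∈ Finset.range N, ((P m).card : ℝ) := by
          exact_mod_cast Finset.card_biUnion_le
      _ ≤ ∑ _m ∈ Finset.range N, (D + 1) := Finset.sum_le_sum fun m _ => hpiece m
      _ = N * (D + 1) := by rw [Finset.sum_const, Finset.card_range, nsmul_eq_mul]
  calc (T.card : ℝ) = ∑ y : ZMod L, (((T.filter fun k => fib k = y)).card : ℝ) := by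
        rw [hfib]; push_cast; rfl
    _ ≤ ∑ _y : ZMod L, (N : ℝ) * (D + 1) := Finset.sum_le_sum fun y _ => hrow y
    _ = L * (N * (D + 1)) := by
        rw [Finset.sum_const, Finset.card_univ, ZMod.card, nsmul_eq_mul]

/-! ### The count for a band on `Fin 2 → ℝ` with coordinate data -/

/-- The lattice momentum of `k ∈ (ℤ/Lℤ)²` is `(2πk₀/L, 2πk₁/L)`. [folklore] -/
private theorem latticeMomentum_two_eq (k : TorusSite 2 L) :
    latticeMomentum L k = ![2 * π * ((k 0).val : ℝ) / L, 2 * π * ((k 1).val : ℝ) / L] := by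
  funext i
  fin_cases i <;> simp [latticeMomentum]

/-- **Level counting on the torus grid from coordinate data.**  Let `e : (Fin 2 → ℝ) → ℝ` have partial
derivatives `de 0`, `de 1` along the two coordinate lines (`hderiv0/1`), each `Kc`-Lipschitz along its own
line (`hlip0/1`).  If `S ⊆ (ℤ/Lℤ)²` is a set of grid points at which `|e| ≤ η` and some coordinate partial is
`≥ c₀ > 0` in size, then for every `N ≥ 1` with `4πKc ≤ c₀N`:
`#S ≤ (4N/(πc₀))·η·L² + 2N·L` (every `L ≥ 1`). [cite: Salmhofer1998, Lemma 4 proof (5.19)–(5.21) (p.20 L26–34)] -/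
theorem card_le_of_coordFloor (e : (Fin 2 → ℝ) → ℝ) (de : Fin 2 → (Fin 2 → ℝ) → ℝ)
    {Kc c₀ η : ℝ} (hKc : 0 ≤ Kc) (hc₀ : 0 < c₀) (hη : 0 ≤ η)
    (hderiv0 : ∀ y t : ℝ, HasDerivAt (fun s => e ![s, y]) (de 0 ![t, y]) t)
    (hderiv1 : ∀ x t : ℝ, HasDerivAt (fun s => e ![x, s]) (de 1 ![x, t]) t)
    (hlip0 : ∀ y t t' : ℝ, |de 0 ![t, y] - de 0 ![t', y]| ≤ Kc * |t - t'|)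
    (hlip1 : ∀ x t t' : ℝ, |de 1 ![x, t] - de 1 ![x, t']| ≤ Kc * |t - t'|)
    (S : Finset (TorusSite 2 L))
    (hsmall : ∀ k ∈ S, |e (latticeMomentum L k)| ≤ η)
    (hsteep : ∀ k ∈ S, c₀ ≤ |de 0 (latticeMomentum L k)| ∨ c₀ ≤ |de 1 (latticeMomentum L k)|)
    {N : ℕ} (hN0 : 0 < N) (hN : 4 * π * Kc ≤ c₀ * N) :
    (S.card : ℝ) ≤ 4 * N / (π * c₀) * η * (L : ℝ) ^ 2 + 2 * N * L := by
  have hL : (0 : ℝ) < L := by exact_mod_cast Nat.pos_of_ne_zero (NeZero.ne L)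
  have hπ := Real.pi_pos
  -- split by the steep coordinate
  set S₀ := S.filter fun k => c₀ ≤ |de 0 (latticeMomentum L k)| with hS₀
  set S₁ := S.filter fun k => c₀ ≤ |de 1 (latticeMomentum L k)| with hS₁
  have hcover : S ⊆ S₀ ∪ S₁ := by
    intro k hk
    rw [Finset.mem_union, hS₀, hS₁, Finset.mem_filter, Finset.mem_filter]
    rcases hsteep k hk with h0 | h1
    · exact Or.inl ⟨hk, h0⟩
    · exact Or.inr ⟨hk, h1⟩
  -- direction `0`: fibres over `k 1`, coordinate `k 0`, lines `s ↦ e (s, y)`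
  have h0 : (S₀.card : ℝ) ≤ L * (N * (4 * η / c₀ * (L / (2 * π)) + 1)) := by
    refine card_le_of_lines S₀ (fun k => k 1) (fun k => k 0) ?_
      (fun y s => e ![s, 2 * π * (y.val : ℝ) / L]) (fun y s => de 0 ![s, 2 * π * (y.val : ℝ) / L])
      hKc hc₀ hη (fun y s => hderiv0 _ s) (fun y s s' => hlip0 _ s s') ?_ ?_ hN0 hN
    · intro k _ k' _ h1 h0
      funext i; fin_cases i
      · exact h0
      · exact h1
    · intro k hk
      rw [hS₀, Finset.mem_filter] at hk
      have := hsmall k hk.1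
      rwa [latticeMomentum_two_eq] at this
    · intro k hk
      rw [hS₀, Finset.mem_filter] at hk
      have := hk.2
      rwa [latticeMomentum_two_eq] at this
  -- direction `1`: fibres over `k 0`, coordinate `k 1`, lines `s ↦ e (x, s)`
  have h1 : (S₁.card : ℝ) ≤ L * (N * (4 * η / c₀ * (L / (2 * π)) + 1)) := by
    refine card_le_of_lines S₁ (fun k => k 0) (fun k => k 1) ?_
      (fun x s => e ![2 * π * (x.val : ℝ) / L, s]) (fun x s => de 1 ![2 * π * (x.val : ℝ) / L, s])
      hKc hc₀ hη (fun x s => hderiv1 _ s) (fun x s s' => hlip1 _ s s') ?_ ?_ hN0 hN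
    · intro k _ k' _ h0 h1
      funext i; fin_cases i
      · exact h0
      · exact h1
    · intro k hk
      rw [hS₁, Finset.mem_filter] at hk
      have := hsmall k hk.1
      rwa [latticeMomentum_two_eq] at this
    · intro k hk
      rw [hS₁, Finset.mem_filter] at hk
      have := hk.2
      rwa [latticeMomentum_two_eq] at this
  have hid : (L : ℝ) * (N * (4 * η / c₀ * (L / (2 * π)) + 1)) =
      2 * N / (π * c₀) * η * (L : ℝ) ^ 2 + N * L := by
    field_simp
    ring
  calc (S.card : ℝ) ≤ ((S₀ ∪ S₁).card : ℝ) := by exact_mod_cast Finset.card_le_card hcover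
    _ ≤ (S₀.card : ℝ) + S₁.card := by exact_mod_cast Finset.card_union_le S₀ S₁
    _ ≤ 2 * (L * (N * (4 * η / c₀ * (L / (2 * π)) + 1))) := by linarith
    _ = 4 * N / (π * c₀) * η * (L : ℝ) ^ 2 + 2 * N * L := by rw [hid]; ring

/-! ### Fréchet form on `EuclideanSpace ℝ (Fin 2)` -/

section Euclidean

/-- A coordinate line through `p` in the Euclidean plane: `toLp (update p j t) = toLp (update p j 0) + t • e_j`.
[folklore] -/
private theorem toLp_update_eq (p : Fin 2 → ℝ) (j : Fin 2) (t : ℝ) :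
    (WithLp.toLp 2 (Function.update p j t) : EuclideanSpace ℝ (Fin 2)) =
      WithLp.toLp 2 (Function.update p j 0) + t • EuclideanSpace.single j (1 : ℝ) := by
  ext i
  by_cases hij : i = j
  · subst hij; simp
  · simp [hij]

/-- `‖φ‖ ≤ |φ e₀| + |φ e₁|` for a linear functional on the Euclidean plane. [folklore] -/
private theorem opNorm_le_abs_add_abs (φ : EuclideanSpace ℝ (Fin 2) →L[ℝ] ℝ) :
    ‖φ‖ ≤ |φ (EuclideanSpace.single 0 (1 : ℝ))| + |φ (EuclideanSpace.single 1 (1 : ℝ))| := by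
  refine ContinuousLinearMap.opNorm_le_bound φ (by positivity) fun v => ?_
  have hv : v = v 0 • EuclideanSpace.single 0 (1 : ℝ) + v 1 • EuclideanSpace.single 1 (1 : ℝ) := by
    ext i
    fin_cases i <;> simp
  have h0 : |v 0| ≤ ‖v‖ := by
    have := PiLp.norm_apply_le v 0
    rwa [Real.norm_eq_abs] at this
  have h1 : |v 1| ≤ ‖v‖ := by
    have := PiLp.norm_apply_le v 1
    rwa [Real.norm_eq_abs] at this
  calc ‖φ v‖ = |v 0 * φ (EuclideanSpace.single 0 (1 : ℝ)) + v 1 * φ (EuclideanSpace.single 1 (1 : ℝ))| := by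
        conv_lhs => rw [hv]
        rw [map_add, map_smul, map_smul, smul_eq_mul, smul_eq_mul, Real.norm_eq_abs]
    _ ≤ |v 0| * |φ (EuclideanSpace.single 0 (1 : ℝ))| + |v 1| * |φ (EuclideanSpace.single 1 (1 : ℝ))| := by
        refine (abs_add_le _ _).trans ?_
        rw [abs_mul, abs_mul]
    _ ≤ ‖v‖ * |φ (EuclideanSpace.single 0 (1 : ℝ))| + ‖v‖ * |φ (EuclideanSpace.single 1 (1 : ℝ))| := by
        gcongr
    _ = (|φ (EuclideanSpace.single 0 (1 : ℝ))| + |φ (EuclideanSpace.single 1 (1 : ℝ))|) * ‖v‖ := by ring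

/-- A gradient floor gives a coordinate floor: `g₀ ≤ ‖Df q‖ ⇒ g₀/2 ≤ |∂₀f q| ∨ g₀/2 ≤ |∂₁f q|`. [folklore] -/
private theorem coordFloor_of_opNorm_ge (φ : EuclideanSpace ℝ (Fin 2) →L[ℝ] ℝ) {g₀ : ℝ} (h : g₀ ≤ ‖φ‖) :
    g₀ / 2 ≤ |φ (EuclideanSpace.single 0 (1 : ℝ))| ∨ g₀ / 2 ≤ |φ (EuclideanSpace.single 1 (1 : ℝ))| := by
  by_contra hcon
  push Not at hcon
  have := opNorm_le_abs_add_abs φ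
  linarith [hcon.1, hcon.2]

variable (f : EuclideanSpace ℝ (Fin 2) → ℝ)

/-- **Level counting on the torus grid for a `C²` band with a gradient floor (non-strict shell).**  For
`f : ℝ² → ℝ` of class `C²` with `‖D²f‖ ≤ Kc` everywhere and `‖Df(q)‖ ≥ g₀ > 0` wherever `|f(q)| < r`, and every
`N ≥ 1` with `8πKc ≤ g₀N`:  for all `L ≥ 1` and `0 ≤ η < r`,
`#{k⃗ ∈ (ℤ/Lℤ)² : |f(2πk⃗/L)| ≤ η} ≤ (8N/(πg₀))·η·L² + 2N·L`.
[cite: Salmhofer1998, Lemma 4 proof (5.19)–(5.21) (p.20 L26–34)] -/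
theorem card_filter_abs_le_le_of_gradient_floor (hf : ContDiff ℝ 2 f) {Kc g₀ r : ℝ} (hKc : 0 ≤ Kc)
    (hg₀ : 0 < g₀) (hD2 : ∀ q, ‖iteratedFDeriv ℝ 2 f q‖ ≤ Kc)
    (hgrad : ∀ q, |f q| < r → g₀ ≤ ‖fderiv ℝ f q‖) {N : ℕ} (hN0 : 0 < N) (hN : 8 * π * Kc ≤ g₀ * N)
    {η : ℝ} (hη : 0 ≤ η) (hηr : η < r) :
    ((Finset.univ.filter fun k : TorusSite 2 L =>
        |f (WithLp.toLp 2 (latticeMomentum L k))| ≤ η).card : ℝ) ≤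
      8 * N / (π * g₀) * η * (L : ℝ) ^ 2 + 2 * N * L := by
  -- coordinate data of `e := f ∘ toLp`
  set e : (Fin 2 → ℝ) → ℝ := fun p => f (WithLp.toLp 2 p) with he
  set de : Fin 2 → (Fin 2 → ℝ) → ℝ := fun j p =>
    fderiv ℝ f (WithLp.toLp 2 p) (EuclideanSpace.single j (1 : ℝ)) with hde
  have hdiff : ∀ x, DifferentiableAt ℝ f x := fun x => (hf.differentiable (by norm_num)) x
  -- `Df` is `Kc`-Lipschitz
  have hfd : ContDiff ℝ 1 (fderiv ℝ f) := hf.fderiv_right (m := 1) (by norm_num)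
  have hlipD : ∀ x x' : EuclideanSpace ℝ (Fin 2), ‖fderiv ℝ f x - fderiv ℝ f x'‖ ≤ Kc * ‖x - x'‖ := by
    intro x x'
    refine (convex_univ).norm_image_sub_le_of_norm_fderiv_le (f := fderiv ℝ f)
      (fun y _ => (hfd.differentiable one_ne_zero) y) (fun y _ => ?_) (Set.mem_univ x') (Set.mem_univ x)
    rw [← norm_iteratedFDeriv_zero (𝕜 := ℝ) (f := fderiv ℝ (fderiv ℝ f)), norm_iteratedFDeriv_fderiv,
      norm_iteratedFDeriv_fderiv]
    exact hD2 y
  -- derivative along a coordinate line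
  have hline : ∀ (p : Fin 2 → ℝ) (j : Fin 2) (t : ℝ),
      HasDerivAt (fun s => e (Function.update p j s)) (de j (Function.update p j t)) t := by
    intro p j t
    have hγ : HasDerivAt (fun s : ℝ => (WithLp.toLp 2 (Function.update p j s) : EuclideanSpace ℝ (Fin 2)))
        (EuclideanSpace.single j (1 : ℝ)) t := by
      have h1 : HasDerivAt (fun s : ℝ => WithLp.toLp 2 (Function.update p j 0) +
          s • EuclideanSpace.single j (1 : ℝ)) (EuclideanSpace.single j (1 : ℝ)) t := by
        simpa using ((hasDerivAt_id t).smul_const (EuclideanSpace.single j (1 : ℝ))).const_add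
          (WithLp.toLp 2 (Function.update p j 0))
      refine h1.congr_of_eventuallyEq (Filter.Eventually.of_forall fun s => ?_)
      exact toLp_update_eq p j s
    have := (hdiff (WithLp.toLp 2 (Function.update p j t))).hasFDerivAt.comp_hasDerivAt t hγ
    simpa [he, hde, Function.comp_def] using this
  -- Lipschitz of the partials along their own lines
  have hlipline : ∀ (p : Fin 2 → ℝ) (j : Fin 2) (t t' : ℝ),
      |de j (Function.update p j t) - de j (Function.update p j t')| ≤ Kc * |t - t'| := by
    intro p j t t'
    have hsub : (WithLp.toLp 2 (Function.update p j t) : EuclideanSpace ℝ (Fin 2)) -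
        WithLp.toLp 2 (Function.update p j t') = (t - t') • EuclideanSpace.single j (1 : ℝ) := by
      rw [toLp_update_eq p j t, toLp_update_eq p j t', sub_smul]; abel
    have hnorm : ‖(WithLp.toLp 2 (Function.update p j t) : EuclideanSpace ℝ (Fin 2)) -
        WithLp.toLp 2 (Function.update p j t')‖ = |t - t'| := by
      rw [hsub, norm_smul, Real.norm_eq_abs]
      simp
    calc |de j (Function.update p j t) - de j (Function.update p j t')|
        = ‖(fderiv ℝ f (WithLp.toLp 2 (Function.update p j t)) -
            fderiv ℝ f (WithLp.toLp 2 (Function.update p j t'))) (EuclideanSpace.single j (1 : ℝ))‖ := by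
          simp only [hde, FunLike.coe_sub, Pi.sub_apply, Real.norm_eq_abs]
      _ ≤ ‖fderiv ℝ f (WithLp.toLp 2 (Function.update p j t)) -
            fderiv ℝ f (WithLp.toLp 2 (Function.update p j t'))‖ * ‖EuclideanSpace.single j (1 : ℝ)‖ :=
          ContinuousLinearMap.le_opNorm _ _
      _ ≤ Kc * |t - t'| * 1 := by
          gcongr
          · exact (hlipD _ _).trans (by rw [hnorm])
          · simp
      _ = Kc * |t - t'| := by ring
  -- specialise the line data to the two coordinate shapes `![s, y]`, `![x, s]`
  have hupd0 : ∀ y s : ℝ, Function.update ![(0 : ℝ), y] 0 s = ![s, y] := by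
    intro y s; funext i; fin_cases i <;> simp
  have hupd1 : ∀ x s : ℝ, Function.update ![x, (0 : ℝ)] 1 s = ![x, s] := by
    intro x s; funext i; fin_cases i <;> simp
  have hderiv0 : ∀ y t : ℝ, HasDerivAt (fun s => e ![s, y]) (de 0 ![t, y]) t := by
    intro y t
    have := hline ![(0 : ℝ), y] 0 t
    simp only [hupd0] at this
    exact this
  have hderiv1 : ∀ x t : ℝ, HasDerivAt (fun s => e ![x, s]) (de 1 ![x, t]) t := by
    intro x t
    have := hline ![x, (0 : ℝ)] 1 t
    simp only [hupd1] at this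
    exact this
  have hlip0 : ∀ y t t' : ℝ, |de 0 ![t, y] - de 0 ![t', y]| ≤ Kc * |t - t'| := by
    intro y t t'
    have := hlipline ![(0 : ℝ), y] 0 t t'
    simp only [hupd0] at this
    exact this
  have hlip1 : ∀ x t t' : ℝ, |de 1 ![x, t] - de 1 ![x, t']| ≤ Kc * |t - t'| := by
    intro x t t'
    have := hlipline ![x, (0 : ℝ)] 1 t t'
    simp only [hupd1] at this
    exact this
  -- the counted set and its steepness
  set S := Finset.univ.filter fun k : TorusSite 2 L => |f (WithLp.toLp 2 (latticeMomentum L k))| ≤ η with hS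
  have hsmall : ∀ k ∈ S, |e (latticeMomentum L k)| ≤ η := by
    intro k hk
    rw [hS, Finset.mem_filter] at hk
    exact hk.2
  have hsteep : ∀ k ∈ S, g₀ / 2 ≤ |de 0 (latticeMomentum L k)| ∨ g₀ / 2 ≤ |de 1 (latticeMomentum L k)| := by
    intro k hk
    have hlt : |f (WithLp.toLp 2 (latticeMomentum L k))| < r := (hsmall k hk).trans_lt hηr
    exact coordFloor_of_opNorm_ge _ (hgrad _ hlt)
  have hN' : 4 * π * Kc ≤ g₀ / 2 * N := by linarith
  have main := card_le_of_coordFloor e de hKc (half_pos hg₀) hη hderiv0 hderiv1 hlip0 hlip1 S hsmall hsteep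
    hN0 hN'
  have hid : 4 * (N : ℝ) / (π * (g₀ / 2)) = 8 * N / (π * g₀) := by
    field_simp; ring
  rw [hid] at main
  exact main

/-- **Level counting on the torus grid for a `C²` band with a gradient floor (strict shell).**  Same
hypotheses; for all `L ≥ 1` and `0 < η ≤ r`:
`#{k⃗ ∈ (ℤ/Lℤ)² : |f(2πk⃗/L)| < η} ≤ (8N/(πg₀))·η·L² + 2N·L` — the shape `c₁ η L² + c₂ L` consumed by the
Gram constant of a single-scale propagator (`InfraredCutoffGramConstant.sum_one_sub_cutoff_div_sqrt_le`).
[cite: Salmhofer1998, Lemma 4 proof (5.19)–(5.21) (p.20 L26–34)] -/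
theorem card_filter_abs_lt_le_of_gradient_floor (hf : ContDiff ℝ 2 f) {Kc g₀ r : ℝ} (hKc : 0 ≤ Kc)
    (hg₀ : 0 < g₀) (hD2 : ∀ q, ‖iteratedFDeriv ℝ 2 f q‖ ≤ Kc)
    (hgrad : ∀ q, |f q| < r → g₀ ≤ ‖fderiv ℝ f q‖) {N : ℕ} (hN0 : 0 < N) (hN : 8 * π * Kc ≤ g₀ * N)
    {η : ℝ} (hη : 0 < η) (hηr : η ≤ r) :
    ((Finset.univ.filter fun k : TorusSite 2 L =>
        |f (WithLp.toLp 2 (latticeMomentum L k))| < η).card : ℝ) ≤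
      8 * N / (π * g₀) * η * (L : ℝ) ^ 2 + 2 * N * L := by
  have hL : (0 : ℝ) < L := by exact_mod_cast Nat.pos_of_ne_zero (NeZero.ne L)
  have hπ := Real.pi_pos
  have hNr : (0 : ℝ) < N := by exact_mod_cast hN0
  -- the strict shell at level `η` lies in the non-strict shell at every level `η' < η`; take the largest
  -- value actually attained (a finite set), or argue by continuity in `η'`: we use the finite maximum.
  set S := Finset.univ.filter fun k : TorusSite 2 L => |f (WithLp.toLp 2 (latticeMomentum L k))| < η with hS
  rcases S.eq_empty_or_nonempty with hSe | hSne
  · rw [hSe, Finset.card_empty, Nat.cast_zero]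
    positivity
  · -- the largest shell value among the counted points
    obtain ⟨k₀, hk₀, hmax⟩ := S.exists_max_image (fun k => |f (WithLp.toLp 2 (latticeMomentum L k))|) hSne
    set η' := |f (WithLp.toLp 2 (latticeMomentum L k₀))| with hη'
    have hη'lt : η' < η := by
      rw [hS, Finset.mem_filter] at hk₀; exact hk₀.2
    have hsub : S ⊆ Finset.univ.filter fun k : TorusSite 2 L =>
        |f (WithLp.toLp 2 (latticeMomentum L k))| ≤ η' := by
      intro k hk
      rw [Finset.mem_filter]
      exact ⟨Finset.mem_univ _, hmax k hk⟩
    have h := card_filter_abs_le_le_of_gradient_floor (L := L) f hf hKc hg₀ hD2 hgrad hN0 hN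
      (abs_nonneg _ : 0 ≤ η') (hη'lt.trans_le hηr)
    calc (S.card : ℝ) ≤ ((Finset.univ.filter fun k : TorusSite 2 L =>
          |f (WithLp.toLp 2 (latticeMomentum L k))| ≤ η').card : ℝ) := by
          exact_mod_cast Finset.card_le_card hsub
      _ ≤ 8 * N / (π * g₀) * η' * (L : ℝ) ^ 2 + 2 * N * L := h
      _ ≤ 8 * N / (π * g₀) * η * (L : ℝ) ^ 2 + 2 * N * L := by
          have : 0 ≤ 8 * N / (π * g₀) * (L : ℝ) ^ 2 := by positivity
          nlinarith

/-- **Level counting keyed by FST II's geometric constants.**  For `f : ℝ² → ℝ` of class `C²` with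
`GeomConstants f Kc r₀ g₀ w` (`‖Dʲf‖ ≤ Kc`, `j ≤ 2`; `|∇f| ≥ g₀` on `{|f| < r₀}`) and `N ≥ 1` with `8πKc ≤ g₀N`:
`#{k⃗ ∈ (ℤ/Lℤ)² : |f(2πk⃗/L)| < η} ≤ (8N/(πg₀))·η·L² + 2N·L` for all `L ≥ 1`, `0 < η ≤ r₀` — uniformly over
every band with the same constants (the moving frames of a counterterm flow).
[cite: FeldmanSalmhoferTrubowitz1998, §2.1–2.2 eq. (gzerinit) (arXiv p.8 L38–41)] -/
theorem card_filter_abs_lt_le_of_geomConstants (hf : ContDiff ℝ 2 f) {Kc r₀ g₀ w : ℝ}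
    (hG : GeomConstants f Kc r₀ g₀ w) {N : ℕ} (hN0 : 0 < N) (hN : 8 * π * Kc ≤ g₀ * N)
    {η : ℝ} (hη : 0 < η) (hηr : η ≤ r₀) :
    ((Finset.univ.filter fun k : TorusSite 2 L =>
        |f (WithLp.toLp 2 (latticeMomentum L k))| < η).card : ℝ) ≤
      8 * N / (π * g₀) * η * (L : ℝ) ^ 2 + 2 * N * L := by
  have hKc : 0 ≤ Kc := (norm_nonneg _).trans (hG.norm_iteratedFDeriv_le 0 2 le_rfl)
  refine card_filter_abs_lt_le_of_gradient_floor f hf hKc hG.g₀_pos (fun q => hG.norm_iteratedFDeriv_le q 2 le_rfl)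
    (fun q hq => ?_) hN0 hN hη hηr
  have := hG.le_norm_gradient q hq
  rwa [gradient, LinearIsometryEquiv.norm_map] at this

/-- The non-strict variant keyed by FST II's constants: `#{k⃗ : |f(2πk⃗/L)| ≤ η} ≤ (8N/(πg₀))·η·L² + 2N·L` for
`0 ≤ η < r₀`. [cite: FeldmanSalmhoferTrubowitz1998, §2.1–2.2 eq. (gzerinit) (arXiv p.8 L38–41)] -/
theorem card_filter_abs_le_le_of_geomConstants (hf : ContDiff ℝ 2 f) {Kc r₀ g₀ w : ℝ}
    (hG : GeomConstants f Kc r₀ g₀ w) {N : ℕ} (hN0 : 0 < N) (hN : 8 * π * Kc ≤ g₀ * N)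
    {η : ℝ} (hη : 0 ≤ η) (hηr : η < r₀) :
    ((Finset.univ.filter fun k : TorusSite 2 L =>
        |f (WithLp.toLp 2 (latticeMomentum L k))| ≤ η).card : ℝ) ≤
      8 * N / (π * g₀) * η * (L : ℝ) ^ 2 + 2 * N * L := by
  have hKc : 0 ≤ Kc := (norm_nonneg _).trans (hG.norm_iteratedFDeriv_le 0 2 le_rfl)
  refine card_filter_abs_le_le_of_gradient_floor f hf hKc hG.g₀_pos (fun q => hG.norm_iteratedFDeriv_le q 2 le_rfl)
    (fun q hq => ?_) hN0 hN hη hηr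
  have := hG.le_norm_gradient q hq
  rwa [gradient, LinearIsometryEquiv.norm_map] at this

end Euclidean

end Literature.MathematicalPhysics.QuantumLattice

end
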